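import Summits.BirchSwinnertonDyer.BirchSwinnertonDyer.Theorems.BiquadraticEisensteinDescentControlCMInertBadAdmOtherBody
import Summits.BirchSwinnertonDyer.BirchSwinnertonDyer.Theses.BiquadraticEisensteinDescent
import HarnessLib

/-!
# Route `BiquadraticEisensteinDescent`: the restated crux C′ `ControlCMInertBadAdmOtherOfGZK`
# (stmt-BirchSwinnertonDyer-20353, β-C′, rev 13) — CLOSED

Seat `bsd-wall-bed-p3` (prover, cell `bsd-wall`, rung W-ALL row CornerF / K12i). One theorem, no `sorry`.
The route planner (cm g4, director-bsd GO-β-C′ 2026-08-27T10:46Z) restated crux C′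
`ControlCMInertBadAdmOther` (stmt 20454, now aside, decl kept) ONCE as
`ControlCMInertBadAdmOtherOfGZK := (∀ N W K, gross_zagier N W K) → (∀ N W K, kolyvagin N W K) →
hasEntireLFunction_rat → <C′ verbatim>` (text = HOME/bsd-wall-bed-p3/C-OfGZK.sig, sha16 73c32ff8b8d2ca5e;
the three antecedents are conjuncts 1, 2, 5 of `PublishedInputsBiquadratic`, fed by `closes` as
`h3 hGZ hKo hmod`). The landed BY-VALUE theorem `ControlCMInertBadAdmOtherBody.c9A` (p525377; same content
as `…ControlCMInertBadAdmOther.controlCMInertBadAdmOther_of_GZK`, p523934: upper half of anticyclotomic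
control at the CM-inert-bad ADDITIVE prime, `X_ac` strict at `𝔭′`, log at `embAt K p 𝔭`, from the tree's
Poitou–Tate / Euler–Poincaré theorems, the additive torsion-weighted Selmer count p523154 and the
log-embedding symmetry) has EXACTLY this type; importing the by-value file keeps this closer out of the
Theses cone of any other module (lint.theses-cone).

References: [JetchevSkinnerWan2017] Thm. 3.3.1, §7.4.1 (arXiv:1512.06894 pp. 11, 30); [GreenbergLNM1716]
§3 Lemma 3.3, §4 Lemma 4.2; [Gross1991] (1.1), Thm. 1.3; [Kolyvagin1990] Thm. A.
-/

set_option linter.dupNamespace false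

namespace Summit.BirchSwinnertonDyer.BirchSwinnertonDyer.Theorems

open Summit.BirchSwinnertonDyer.BirchSwinnertonDyer.Theses.BiquadraticEisensteinDescent

/-- **Crux C′ restated (β-C′), `ControlCMInertBadAdmOtherOfGZK`, PROVED**: for a CM curve `W/ℚ` of
analytic rank one, `p ≥ 5` inert in the CM field and bad, every admissible Heegner datum over an imaginary
quadratic `K′` with the Heegner hypothesis, every anticyclotomic `(κ, γ)`, degree-one `𝔭 ∋ p` and the other
prime `𝔭′ ∋ p`: `X_{𝔭′}(E_{K′}[p^∞])` is `Λ`-torsion with `ord_p f(0) = n ≤ ord_p #Ш(E/K′)[p^∞] +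
2·(ord_p log_{ω,𝔭} P − ord_p[E(K′):ℤP]) + ord_p ∏_{w∣N⁺} c_w(E/K′)`, GRANTED Gross–Zagier, Kolyvagin and
modularity (the route's published inputs). The closer is the landed `ControlCMInertBadAdmOtherBody.c9A`.
[cite: JetchevSkinnerWan2017, Thm. 3.3.1 and §7.4.1 (arXiv:1512.06894 pp. 11, 30)]
[cite: GreenbergLNM1716, §3 Lemma 3.3 (p. 87), §4 Lemma 4.2 (p. 102)] [cite: Gross1991, (1.1) and Thm. 1.3]
[cite: Kolyvagin1990, Thm. A] -/
theorem controlCMInertBadAdmOtherOfGZK_proof : ControlCMInertBadAdmOtherOfGZK :=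
  ControlCMInertBadAdmOtherBody.c9A

end Summit.BirchSwinnertonDyer.BirchSwinnertonDyer.Theorems
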